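import Summits.HodgeConjecture.CorCM.GaloisQuaternionCyclicTwoSheetSets
import HarnessLib

/-!
# The two-sheet format for arbitrary fibres: the convolution counts need only be checked for `d ∈ {0, …, m}` (`F_{−d} = F_d`)

COR-CM (cell `pub-hodgecm2`), binder seat b04 (gen 42), count-neutral own lane «Galois-CM-type classification» (blanket
`CorCM/Galois*`).  KERNEL ONLY: theorems; no definition, no named fact, no `sorry`.  `HC_CM` is neither used nor claimed.

The convolution counts `F_d(s) = Σ_j #{v ∈ J_{j+d} : s − v ∈ J_j}` of `CorCM/GaloisQuaternionCyclicTwoSheetSets` satisfy `F_{−d} = F_d`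
(reindex `j ↦ j + d`, `v ↦ s − v`), so the per-instance `decide` of `exists_simple_degenerate_of_quaternion_cyclic_sets` may be restricted to
the `m + 1` shifts `d` with `d.val ≤ m` — half the kernel work for the larger certificates (`m = 8, 16`).

* `convCount_neg` — `F_{−d} = F_d` for one sheet.
* **`exists_simple_degenerate_of_quaternion_cyclic_sets_half`** — the Galois dress with the halved hypothesis.
-/

noncomputable section

open scoped BigOperators

namespace Summit.HodgeConjecture.CorCM.GaloisQuaternionCyclic

/-- `F_{−d}(s) = F_d(s)`: `Σ_j Σ_v [v ∈ J_{j−d}][s − v ∈ J_j] = Σ_j Σ_v [v ∈ J_{j+d}][s − v ∈ J_j]` (reindex `j ↦ j + d`, `v ↦ s − v`). [folklore] -/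
theorem convCount_neg {n p : ℕ} [NeZero n] [NeZero p] (J : ZMod n → ZMod p → Bool) (d : ZMod n) (s : ZMod p) :
    ∑ j : ZMod n, ∑ v : ZMod p, (J (j + -d) v && J j (s - v)).toNat =
      ∑ j : ZMod n, ∑ v : ZMod p, (J (j + d) v && J j (s - v)).toNat := by
  classical
  calc ∑ j : ZMod n, ∑ v : ZMod p, (J (j + -d) v && J j (s - v)).toNat
      = ∑ j : ZMod n, ∑ v : ZMod p, (J j v && J (j + d) (s - v)).toNat := by
        refine (Fintype.sum_equiv (Equiv.addRight d) _ _ fun j => ?_).symm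
        simp only [Equiv.coe_addRight, add_neg_cancel_right]
    _ = ∑ j : ZMod n, ∑ v : ZMod p, (J (j + d) v && J j (s - v)).toNat := by
        refine Finset.sum_congr rfl fun j _ => ?_
        refine Fintype.sum_equiv (Equiv.subLeft s) _ _ fun v => ?_
        simp only [Equiv.subLeft_apply, sub_sub_cancel, Bool.and_comm]

end Summit.HodgeConjecture.CorCM.GaloisQuaternionCyclic

namespace Summit.HodgeConjecture.CorCM.GaloisModels

open CategoryTheory CategoryTheory.Limits NumberField
open Literature.NumberTheory.ComplexMultiplication
open Literature.AlgebraicGeometry.Motives (AbelianVariety CMType)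
open Literature.AlgebraicGeometry.HodgeTheory
open Literature.AlgebraicGeometry.ComplexMultiplication (IsCMTypeRealisation)
open Literature.AlgebraicGeometry.Pohlmann1968
open Literature.Barriers.HodgeConjecture (divisorClassesSpan)
open Summit.HodgeConjecture.CorCM.GaloisRank
open Summit.HodgeConjecture.CorCM.GaloisQuaternionCyclic (convCount_neg)
open QuaternionGroup

variable {K : Type} [Field K] [NumberField K] [IsCMField K]

/-- **The Galois dress of the two-sheet format for arbitrary fibres, with the convolution identities required only for the shifts
`d` with `d.val ≤ m`** (the others follow from `F_{−d} = F_d`).  Hypotheses otherwise as in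
`exists_simple_degenerate_of_quaternion_cyclic_sets`. [cite: Shimura1998, §6.2 Thm. 3 and §8.2 Prop. 26]
[cite: Gordon1999HodgeAVSurvey, Thm. 6.4 and §9.3] [cite: Kubota1965, §4 Lemma 2] -/
theorem exists_simple_degenerate_of_quaternion_cyclic_sets_half [IsGalois ℚ K] {m p : ℕ} [NeZero m] [Fact p.Prime]
    (hm : 2 ≤ m) (hcop : Nat.Coprime (4 * m) p) {A X u : K ≃ₐ[ℚ] K} (hA : orderOf A = 2 * m)
    (hX : X * X = A ^ m) (hXA : X * A * X⁻¹ = A⁻¹) (hc : A ^ m = (IsCMField.complexConj K).restrictScalars ℚ)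
    (hu : orderOf u = p) (hAu : A * u = u * A) (hXu : X * u = u * X) (hnorm : (Subgroup.zpowers u).Normal)
    (Ju Jv : ZMod (2 * m) → ZMod p → Bool)
    (P : QuaternionGroup m × Multiplicative (ZMod p) → Prop) [DecidablePred P]
    (hPa : ∀ (j : ZMod (2 * m)) (v : ZMod p), P (a j, Multiplicative.ofAdd v) ↔ Ju j v = true)
    (hPx : ∀ (j : ZMod (2 * m)) (v : ZMod p), P (xa j, Multiplicative.ofAdd v) ↔ Jv j v = true)
    (hcm₁ : ∀ x, P x ↔ ¬ P (((a m, 1) : QuaternionGroup m × Multiplicative (ZMod p)) * x))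
    (hprim₁ : ∀ v : QuaternionGroup m × Multiplicative (ZMod p), v ≠ 1 → ∃ w, ¬ (P w ↔ P (v * w)))
    (c : ZMod (2 * m) → ℕ)
    (hF : ∀ d : ZMod (2 * m), d.val ≤ m → ∀ s : ZMod p, ∑ j : ZMod (2 * m), ∑ v : ZMod p,
      ((Ju (j + d) v && Ju j (s - v)).toNat + (Jv (j + d) v && Jv j (s - v)).toNat) = c d) :
    ∃ (Φ : CMType K) (φ₀ : K →+* ℂ) (A : AbelianVariety ℂ) (ι : 𝓞 K →+* End A)
      (θ : K →+* Module.End ℂ (complexBetti A.X 1)),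
      IsPrimitive (ℂ ≃+* ℂ) Φ.1 φ₀ ∧ ¬ IsNondegenerate Φ ∧ IsCMTypeRealisation Φ A ι θ ∧ A.IsSimple ∧
      A.dim = Module.finrank ℚ K / 2 ∧
      ∃ n p : ℕ, ∃ x : complexBetti (⨁ fun _ : Fin n => A).X (2 * p), IsRationalClass x ∧
        IsOfHodgeType (⨁ fun _ : Fin n => A).dim (⨁ fun _ : Fin n => A).X (2 * p) p p x ∧
        x ∉ divisorClassesSpan (⨁ fun _ : Fin n => A).X (⨁ fun _ : Fin n => A).dim p := by
  classical
  haveI : NeZero p := ⟨(Fact.out : p.Prime).ne_zero⟩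
  refine exists_simple_degenerate_of_quaternion_cyclic_sets hm hcop hA hX hXA hc hu hAu hXu hnorm Ju Jv P hPa hPx hcm₁ hprim₁
    (fun d => if d.val ≤ m then c d else c (-d)) fun d s => ?_
  by_cases hd : d.val ≤ m
  · rw [if_pos hd]; exact hF d hd s
  · rw [if_neg hd]
    have hneg : (-d).val ≤ m := by
      have hd0 : d ≠ 0 := by rintro rfl; simp at hd
      haveI : NeZero (2 * m) := ⟨by have := NeZero.ne m; omega⟩
      rw [ZMod.neg_val, if_neg hd0]
      have := d.val_lt
      omega
    have h := hF (-d) hneg s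
    simp only [Finset.sum_add_distrib] at h ⊢
    rw [← convCount_neg Ju d s, ← convCount_neg Jv d s]
    exact h

end Summit.HodgeConjecture.CorCM.GaloisModels

end
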